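import Literature.NumberTheory.Automorphic.UnitaryGroupContinuousOfMatrix     -- ★ p844150 (this seat): continuity into `U(σ,J)` ∕ `(cmDatum L N H).Local v` from matrices
import Literature.NumberTheory.Automorphic.LocalUnitaryGroupCongr              -- ★ `localNonsplitEquiv`, `placeForm` (one-place model `U(Φ₂)_v ≃ₜ* U(σ_w, Φ₂)(L_w)`)
import HarnessLib

/-!
# Continuity of WINDOW FAMILIES `t ↦ (E₂⁻¹ (u t), (↑t).2) ∈ H_v` from continuity of the `L_w`-matrix of `u t`
# (road «R1LL-WILD» (Ψ3): the `hN`∕`hND` sockets of `wildWindow_eventually_eq`, reduced to entrywise continuity at the place `w`)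

Topic `NumberTheory/Automorphic`; namespace `Literature.NumberTheory.Automorphic.UnitaryGroup`.  THEOREMS ONLY (no definition, no instance, no notation,
no named fact, no `sorry`).  Cell `pub/hodgecm-mathlib` (D-0151), crux H413 = `stmt-HodgeConjecture-24833`; architect A-p16 (g28) A-37∕A-44, (W′-B6) F0P3-p01 (g14)
sub-socket map 12:05Z «B-p04 proves `ContinuousAt (N i) s`»; (B6-V) holders p08 (g15) ∕ B-p14 (g33) (B-p08 (g28)'s ρ-side note 12:03:55Z: the normal form is
`N i t := (E₂.symm (d′ (s_t • ι(M_i t)) d), (↑t).2)` — descent scalar `s_t`, `GL₂(L⁺_v)`-matrix `M_i t`, `d = diag(1, α)`).  FILE 2d of the (Ψ3) chain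
★ p844033 → ★ p844096 → ★ p844135 (`wildWindow_eventually_eq`, socket `hN`) + ★ p844150.

THE POINT.  The one-place model `U(σ_w, Φ₂)(L_w) ≤ GL₂(L_w)` is a unitary group of the SELF-INVERSE form `Φ₂ ⊗ 1` for the CONTINUOUS involution `σ_w`
(★ `continuous_galAdicCompletionMap`), so ★ `continuousAt_of_coe` applies: a map into it is continuous at a point as soon as its `L_w`-MATRIX is (§1).  Transport through
any topological-group isomorphism `E₂ : U(Φ₂)_v ≃ₜ* U(σ_w, Φ₂)(L_w)` and pairing with a continuous `U(Φ₁)_v`-component gives the window-family shape (§2); the matrix of a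
descent normal form `d′ * (s • M.map ι) * d` is continuous at a point as soon as the scalar `s` and the small matrix `M` are (§3, jointly continuous polynomial map), and a
`2 × 2` matrix is continuous iff its four entries are (§3).  Hence `hN` for the (B6-V) normal form = continuity AT THE SINGULAR POINTS of the descent scalar `s_t ∈ L_w` and of
the entries of `M_i t ∈ M₂(L⁺_v)` — the torus pack's frame coordinates (★ p843400 `continuous_frameEntry_apply`).

* §1 `placeForm_antidiagTwo_mul_self`; `placeUnitary_continuousAt_of_coe`, `placeUnitary_continuous_of_coe`.
* §2 `continuousAt_symm_apply_of_coe` (through `E₂.symm`), **`continuousAt_windowFamily_of_coe`** (`t ↦ (E₂.symm (u t), p t)`), `continuousAt_windowFamily_centralizer_of_coe`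
  (`p t := (↑t).2` on `Z(t₀)`), and the `Continuous` versions.
* §3 `continuousAt_matrix_two_of_entries`, `continuous_descentForm`, `continuousAt_descentForm_of_continuousAt`.

HONEST LABEL: HC_CM is proved only modulo the 2 remaining named inputs (hLiu418, h413) until rung 0 closes; unconditional topology.

## References
* [PlatonovRapinchuk1994] V. Platonov, A. Rapinchuk, *Algebraic Groups and Number Theory* (1994): §3.1 (topology of `G(K_v)` by matrix entries), §5.1.
* [Mok2014] C. P. Mok, Mem. AMS 235 (2015): §1 Notation p. 5 (the antidiagonal form).
* [LabesseLanglands1979] J.-P. Labesse, R. P. Langlands, Canad. J. Math. 31 (1979): §2 p. 9 (the window).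
-/

set_option autoImplicit false

noncomputable section

open Set Filter Topology Matrix NumberField IsDedekindDomain

namespace Literature.NumberTheory.Automorphic.UnitaryGroup

open Literature.NumberTheory.Automorphic

/-! ## §1 The one-place model `U(σ_w, Φ₂)(L_w)` -/

section Place

variable (L : Type) [Field L] [NumberField L] [IsCMField L] (v : HeightOneSpectrum (𝓞 ↥(maximalRealSubfield L)))
  (w : PlacesOver L v) (hw : IsCMField.complexConj L • w.1 = w.1)
variable {X : Type*} [TopologicalSpace X]

omit [IsCMField L] in
/-- `(Φ₂ ⊗ 1)² = 1` over `L_w`. [cite: Mok2014, §1 Notation p. 5 (the antidiagonal `J`)] -/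
theorem placeForm_antidiagTwo_mul_self :
    placeForm (Matrix.of fun i j : Fin 2 => if i.val + j.val + 1 = 2 then (1 : L) else 0) w.1 * placeForm (Matrix.of fun i j : Fin 2 => if i.val + j.val + 1 = 2 then (1 : L) else 0) w.1 = 1 := by
  ext i j
  fin_cases i <;> fin_cases j <;> simp [placeForm, Matrix.map_apply, Matrix.mul_apply, Fin.sum_univ_two]

include hw in
/-- **Continuity into `U(σ_w, Φ₂)(L_w)` at a point is continuity of the `L_w`-matrix.** [cite: PlatonovRapinchuk1994, §3.1] -/
theorem placeUnitary_continuousAt_of_coe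
    {u : X → ↥(unitaryGroupOfForm (galAdicCompletionMap (L := L) (IsCMField.complexConj L) hw) (placeForm (Matrix.of fun i j : Fin 2 => if i.val + j.val + 1 = 2 then (1 : L) else 0) w.1))} {x₀ : X}
    (h : ContinuousAt (fun x => ((u x : GL (Fin 2) (w.1.adicCompletion L)) : Matrix (Fin 2) (Fin 2) (w.1.adicCompletion L))) x₀) :
    ContinuousAt u x₀ :=
  continuousAt_of_coe (continuous_galAdicCompletionMap (L := L) (IsCMField.complexConj L) hw) (placeForm_antidiagTwo_mul_self L v w) h

include hw in
/-- Global form. [cite: PlatonovRapinchuk1994, §3.1] -/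
theorem placeUnitary_continuous_of_coe
    {u : X → ↥(unitaryGroupOfForm (galAdicCompletionMap (L := L) (IsCMField.complexConj L) hw) (placeForm (Matrix.of fun i j : Fin 2 => if i.val + j.val + 1 = 2 then (1 : L) else 0) w.1))}
    (h : Continuous fun x => ((u x : GL (Fin 2) (w.1.adicCompletion L)) : Matrix (Fin 2) (Fin 2) (w.1.adicCompletion L))) :
    Continuous u :=
  continuous_of_coe (continuous_galAdicCompletionMap (L := L) (IsCMField.complexConj L) hw) (placeForm_antidiagTwo_mul_self L v w) h

/-! ## §2 Window families `t ↦ (E₂⁻¹ (u t), p t) ∈ H_v` -/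

include hw in
/-- Through a topological model `E₂ : U(Φ₂)_v ≃ₜ* U(σ_w, Φ₂)(L_w)`: `x ↦ E₂.symm (u x)` is continuous at `x₀` as soon as the `L_w`-matrix of `u x` is.
[cite: PlatonovRapinchuk1994, §3.1, §5.1] -/
theorem continuousAt_symm_apply_of_coe
    (E₂ : (cmDatum L 2 (Matrix.of fun i j : Fin 2 => if i.val + j.val + 1 = 2 then (1 : L) else 0)).Local v ≃ₜ* ↥(unitaryGroupOfForm (galAdicCompletionMap (L := L) (IsCMField.complexConj L) hw) (placeForm (Matrix.of fun i j : Fin 2 => if i.val + j.val + 1 = 2 then (1 : L) else 0) w.1)))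
    {u : X → ↥(unitaryGroupOfForm (galAdicCompletionMap (L := L) (IsCMField.complexConj L) hw) (placeForm (Matrix.of fun i j : Fin 2 => if i.val + j.val + 1 = 2 then (1 : L) else 0) w.1))} {x₀ : X}
    (h : ContinuousAt (fun x => ((u x : GL (Fin 2) (w.1.adicCompletion L)) : Matrix (Fin 2) (Fin 2) (w.1.adicCompletion L))) x₀) :
    ContinuousAt (fun x => E₂.symm (u x)) x₀ :=
  E₂.symm.continuous.continuousAt.comp (placeUnitary_continuousAt_of_coe L v w hw h)

include hw in
/-- **THE WINDOW-FAMILY SHAPE**: `x ↦ (E₂.symm (u x), p x) ∈ H_v = U(Φ₂)_v × U(Φ₁)_v` is continuous at `x₀` as soon as the `L_w`-matrix of `u x` and the second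
component `p` are. [cite: PlatonovRapinchuk1994, §3.1, §5.1] [cite: LabesseLanglands1979, §2 p. 9] -/
theorem continuousAt_windowFamily_of_coe
    (E₂ : (cmDatum L 2 (Matrix.of fun i j : Fin 2 => if i.val + j.val + 1 = 2 then (1 : L) else 0)).Local v ≃ₜ* ↥(unitaryGroupOfForm (galAdicCompletionMap (L := L) (IsCMField.complexConj L) hw) (placeForm (Matrix.of fun i j : Fin 2 => if i.val + j.val + 1 = 2 then (1 : L) else 0) w.1)))
    {u : X → ↥(unitaryGroupOfForm (galAdicCompletionMap (L := L) (IsCMField.complexConj L) hw) (placeForm (Matrix.of fun i j : Fin 2 => if i.val + j.val + 1 = 2 then (1 : L) else 0) w.1))} {p : X → (cmDatum L 1 (Matrix.of fun i j : Fin 1 => if i.val + j.val + 1 = 1 then (1 : L) else 0)).Local v} {x₀ : X}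
    (h : ContinuousAt (fun x => ((u x : GL (Fin 2) (w.1.adicCompletion L)) : Matrix (Fin 2) (Fin 2) (w.1.adicCompletion L))) x₀)
    (hp : ContinuousAt p x₀) :
    ContinuousAt (fun x => ((E₂.symm (u x), p x) : ((cmDatum L 2 (Matrix.of fun i j : Fin 2 => if i.val + j.val + 1 = 2 then (1 : L) else 0)).Local v × (cmDatum L 1 (Matrix.of fun i j : Fin 1 => if i.val + j.val + 1 = 1 then (1 : L) else 0)).Local v))) x₀ :=
  (continuousAt_symm_apply_of_coe L v w hw E₂ h).prodMk hp

include hw in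
/-- Global form of the window-family shape. [cite: PlatonovRapinchuk1994, §3.1, §5.1] -/
theorem continuous_windowFamily_of_coe
    (E₂ : (cmDatum L 2 (Matrix.of fun i j : Fin 2 => if i.val + j.val + 1 = 2 then (1 : L) else 0)).Local v ≃ₜ* ↥(unitaryGroupOfForm (galAdicCompletionMap (L := L) (IsCMField.complexConj L) hw) (placeForm (Matrix.of fun i j : Fin 2 => if i.val + j.val + 1 = 2 then (1 : L) else 0) w.1)))
    {u : X → ↥(unitaryGroupOfForm (galAdicCompletionMap (L := L) (IsCMField.complexConj L) hw) (placeForm (Matrix.of fun i j : Fin 2 => if i.val + j.val + 1 = 2 then (1 : L) else 0) w.1))} {p : X → (cmDatum L 1 (Matrix.of fun i j : Fin 1 => if i.val + j.val + 1 = 1 then (1 : L) else 0)).Local v}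
    (h : Continuous fun x => ((u x : GL (Fin 2) (w.1.adicCompletion L)) : Matrix (Fin 2) (Fin 2) (w.1.adicCompletion L))) (hp : Continuous p) :
    Continuous fun x => ((E₂.symm (u x), p x) : ((cmDatum L 2 (Matrix.of fun i j : Fin 2 => if i.val + j.val + 1 = 2 then (1 : L) else 0)).Local v × (cmDatum L 1 (Matrix.of fun i j : Fin 1 => if i.val + j.val + 1 = 1 then (1 : L) else 0)).Local v)) :=
  (E₂.symm.continuous.comp (placeUnitary_continuous_of_coe L v w hw h)).prodMk hp

include hw in
/-- **On the torus `Z(t₀)`** with the second component `(↑t).2` of `t` itself: `t ↦ (E₂.symm (u t), (↑t).2)` is continuous at `s` as soon as the `L_w`-matrix of `u t` is —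
the `hN`∕`hND` sockets of ★ `wildWindow_eventually_eq`. [cite: LabesseLanglands1979, §2 p. 9] [cite: PlatonovRapinchuk1994, §3.1] -/
theorem continuousAt_windowFamily_centralizer_of_coe
    (E₂ : (cmDatum L 2 (Matrix.of fun i j : Fin 2 => if i.val + j.val + 1 = 2 then (1 : L) else 0)).Local v ≃ₜ* ↥(unitaryGroupOfForm (galAdicCompletionMap (L := L) (IsCMField.complexConj L) hw) (placeForm (Matrix.of fun i j : Fin 2 => if i.val + j.val + 1 = 2 then (1 : L) else 0) w.1)))
    (t₀ : ((cmDatum L 2 (Matrix.of fun i j : Fin 2 => if i.val + j.val + 1 = 2 then (1 : L) else 0)).Local v × (cmDatum L 1 (Matrix.of fun i j : Fin 1 => if i.val + j.val + 1 = 1 then (1 : L) else 0)).Local v))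
    {u : ↥(Subgroup.centralizer ({t₀} : Set ((cmDatum L 2 (Matrix.of fun i j : Fin 2 => if i.val + j.val + 1 = 2 then (1 : L) else 0)).Local v × (cmDatum L 1 (Matrix.of fun i j : Fin 1 => if i.val + j.val + 1 = 1 then (1 : L) else 0)).Local v))) → ↥(unitaryGroupOfForm (galAdicCompletionMap (L := L) (IsCMField.complexConj L) hw) (placeForm (Matrix.of fun i j : Fin 2 => if i.val + j.val + 1 = 2 then (1 : L) else 0) w.1))}
    {s : ↥(Subgroup.centralizer ({t₀} : Set ((cmDatum L 2 (Matrix.of fun i j : Fin 2 => if i.val + j.val + 1 = 2 then (1 : L) else 0)).Local v × (cmDatum L 1 (Matrix.of fun i j : Fin 1 => if i.val + j.val + 1 = 1 then (1 : L) else 0)).Local v)))}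
    (h : ContinuousAt (fun t => ((u t : GL (Fin 2) (w.1.adicCompletion L)) : Matrix (Fin 2) (Fin 2) (w.1.adicCompletion L))) s) :
    ContinuousAt (fun t : ↥(Subgroup.centralizer ({t₀} : Set ((cmDatum L 2 (Matrix.of fun i j : Fin 2 => if i.val + j.val + 1 = 2 then (1 : L) else 0)).Local v × (cmDatum L 1 (Matrix.of fun i j : Fin 1 => if i.val + j.val + 1 = 1 then (1 : L) else 0)).Local v))) => ((E₂.symm (u t), (t : ((cmDatum L 2 (Matrix.of fun i j : Fin 2 => if i.val + j.val + 1 = 2 then (1 : L) else 0)).Local v × (cmDatum L 1 (Matrix.of fun i j : Fin 1 => if i.val + j.val + 1 = 1 then (1 : L) else 0)).Local v)).2) : ((cmDatum L 2 (Matrix.of fun i j : Fin 2 => if i.val + j.val + 1 = 2 then (1 : L) else 0)).Local v × (cmDatum L 1 (Matrix.of fun i j : Fin 1 => if i.val + j.val + 1 = 1 then (1 : L) else 0)).Local v))) s :=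
  continuousAt_windowFamily_of_coe L v w hw E₂ h (continuous_snd.comp continuous_subtype_val).continuousAt

include hw in
/-- Global torus form. [cite: LabesseLanglands1979, §2 p. 9] [cite: PlatonovRapinchuk1994, §3.1] -/
theorem continuous_windowFamily_centralizer_of_coe
    (E₂ : (cmDatum L 2 (Matrix.of fun i j : Fin 2 => if i.val + j.val + 1 = 2 then (1 : L) else 0)).Local v ≃ₜ* ↥(unitaryGroupOfForm (galAdicCompletionMap (L := L) (IsCMField.complexConj L) hw) (placeForm (Matrix.of fun i j : Fin 2 => if i.val + j.val + 1 = 2 then (1 : L) else 0) w.1)))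
    (t₀ : ((cmDatum L 2 (Matrix.of fun i j : Fin 2 => if i.val + j.val + 1 = 2 then (1 : L) else 0)).Local v × (cmDatum L 1 (Matrix.of fun i j : Fin 1 => if i.val + j.val + 1 = 1 then (1 : L) else 0)).Local v))
    {u : ↥(Subgroup.centralizer ({t₀} : Set ((cmDatum L 2 (Matrix.of fun i j : Fin 2 => if i.val + j.val + 1 = 2 then (1 : L) else 0)).Local v × (cmDatum L 1 (Matrix.of fun i j : Fin 1 => if i.val + j.val + 1 = 1 then (1 : L) else 0)).Local v))) → ↥(unitaryGroupOfForm (galAdicCompletionMap (L := L) (IsCMField.complexConj L) hw) (placeForm (Matrix.of fun i j : Fin 2 => if i.val + j.val + 1 = 2 then (1 : L) else 0) w.1))}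
    (h : Continuous fun t => ((u t : GL (Fin 2) (w.1.adicCompletion L)) : Matrix (Fin 2) (Fin 2) (w.1.adicCompletion L))) :
    Continuous fun t : ↥(Subgroup.centralizer ({t₀} : Set ((cmDatum L 2 (Matrix.of fun i j : Fin 2 => if i.val + j.val + 1 = 2 then (1 : L) else 0)).Local v × (cmDatum L 1 (Matrix.of fun i j : Fin 1 => if i.val + j.val + 1 = 1 then (1 : L) else 0)).Local v))) => ((E₂.symm (u t), (t : ((cmDatum L 2 (Matrix.of fun i j : Fin 2 => if i.val + j.val + 1 = 2 then (1 : L) else 0)).Local v × (cmDatum L 1 (Matrix.of fun i j : Fin 1 => if i.val + j.val + 1 = 1 then (1 : L) else 0)).Local v)).2) : ((cmDatum L 2 (Matrix.of fun i j : Fin 2 => if i.val + j.val + 1 = 2 then (1 : L) else 0)).Local v × (cmDatum L 1 (Matrix.of fun i j : Fin 1 => if i.val + j.val + 1 = 1 then (1 : L) else 0)).Local v)) :=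
  continuous_windowFamily_of_coe L v w hw E₂ h (continuous_snd.comp continuous_subtype_val)

end Place

/-! ## §3 Entrywise criteria for the matrix -/

section Entries

variable {X : Type*} [TopologicalSpace X] {R : Type*} [TopologicalSpace R]

/-- A `2 × 2` matrix-valued map is continuous at `x₀` as soon as its four entries are. [cite: PlatonovRapinchuk1994, §3.1] -/
theorem continuousAt_matrix_two_of_entries {a b c d : X → R} {x₀ : X}
    (ha : ContinuousAt a x₀) (hb : ContinuousAt b x₀) (hc : ContinuousAt c x₀) (hd : ContinuousAt d x₀) :
    ContinuousAt (fun x => !![a x, b x; c x, d x]) x₀ := by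
  refine continuousAt_pi.2 fun i => continuousAt_pi.2 fun j => ?_
  fin_cases i <;> fin_cases j
  · simpa using ha
  · simpa using hb
  · simpa using hc
  · simpa using hd

/-- A `2 × 2` matrix-valued map is continuous as soon as its four entries are. [cite: PlatonovRapinchuk1994, §3.1] -/
theorem continuous_matrix_two_of_entries {a b c d : X → R}
    (ha : Continuous a) (hb : Continuous b) (hc : Continuous c) (hd : Continuous d) :
    Continuous fun x => !![a x, b x; c x, d x] :=
  continuous_iff_continuousAt.2 fun _ => continuousAt_matrix_two_of_entries ha.continuousAt hb.continuousAt hc.continuousAt hd.continuousAt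

variable {F E : Type*} [CommRing F] [CommRing E] [TopologicalSpace F] [TopologicalSpace E] [IsTopologicalRing E]
  {n : Type*} [Fintype n] [DecidableEq n]

omit [DecidableEq n] in
/-- The DESCENT NORMAL FORM `(s, M) ↦ d′ * (s • M.map ι) * d` is jointly continuous (`ι` continuous; `d, d′` fixed). [cite: PlatonovRapinchuk1994, §3.1] -/
theorem continuous_descentForm {ι : F →+* E} (hι : Continuous ι) (d d' : Matrix n n E) :
    Continuous fun p : E × Matrix n n F => d' * (p.1 • (p.2).map ι) * d :=
  (continuous_const.matrix_mul (continuous_fst.smul (continuous_snd.matrix_map hι))).matrix_mul continuous_const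

omit [DecidableEq n] in
/-- **The matrix of a descent normal form is continuous at `x₀` as soon as the scalar `s` and the small matrix `M` are.** [cite: PlatonovRapinchuk1994, §3.1] -/
theorem continuousAt_descentForm_of_continuousAt {ι : F →+* E} (hι : Continuous ι) (d d' : Matrix n n E)
    {s : X → E} {M : X → Matrix n n F} {x₀ : X} (hs : ContinuousAt s x₀) (hM : ContinuousAt M x₀) :
    ContinuousAt (fun x => d' * (s x • (M x).map ι) * d) x₀ := by
  have h2 : ContinuousAt (fun x => (s x, M x)) x₀ := hs.prodMk hM
  have h := ContinuousAt.comp (f := fun x => (s x, M x)) (g := fun p : E × Matrix n n F => d' * (p.1 • (p.2).map ι) * d)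
    (continuous_descentForm hι d d').continuousAt h2
  exact h

omit [DecidableEq n] in
/-- Global form. [cite: PlatonovRapinchuk1994, §3.1] -/
theorem continuous_descentForm_of_continuous {ι : F →+* E} (hι : Continuous ι) (d d' : Matrix n n E)
    {s : X → E} {M : X → Matrix n n F} (hs : Continuous s) (hM : Continuous M) :
    Continuous fun x => d' * (s x • (M x).map ι) * d := by
  have h := Continuous.comp (f := fun x => (s x, M x)) (g := fun p : E × Matrix n n F => d' * (p.1 • (p.2).map ι) * d)
    (continuous_descentForm hι d d') (hs.prodMk hM)
  exact h

end Entries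

end Literature.NumberTheory.Automorphic.UnitaryGroup

end
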